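import Literature.Barriers.CriticalPhenomena.PlaquetteWalkHoleRootCutLawSharp
import Literature.Barriers.CriticalPhenomena.PlaquetteWalkHoleRootOneLiveRow
import Literature.Barriers.CriticalPhenomena.PlaquetteWalkHoleRootRootNotchLiveColumn
import HarnessLib

/-!
# Barrier catalogue (SAWScalingLimit): THE CUT CRITERION IS SHARP, II — the dead door with the row behind it, and the root
notch with the first ray cell: box biconditionals for the remaining empty cells of the ring + near census

Leaf of `PlaquetteWalkHoleRootCutLawSharp` (placement `block_hroot_subset_boxMinus_pair`, the witness pattern),
`PlaquetteWalkHoleRootOneLiveRow` (★ ONE LIVE ROW: `lawL_box_oneLiveRow3_not_wound_under` — `h.2 = 3`, the door `holeS | rootS`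
dead and the side below it dead ⇒ no wound under-walk; the general `ΩG.WE_eq_excursionWinding_of_over_oneLiveRowN`) and
`PlaquetteWalkHoleRootRootNotchLiveColumn` (★ ONE LIVE RAY COLUMN: `lawL_box_rootS_rootEcol_not_wound_under` — `h.1 + 4 = m`,
`rootS` and `rootE | pocketSE` removed ⇒ no wound under-walk; over twin). Setting: the `m × n` box minus `S ∋ h`, hole `h`, root
plaquette `(h.1 + 1, h.2)` rooted at `W`, far cell `(h.1 − 1, h.2)`; reference coordinates root `(4, 2)`, hole `(3, 2)`.

Of the sixteen route-cells of the venture lane's ring + near pair census (kit j300087, frame `[0,6]×[−1,5]`) that the cut theory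
proves EMPTY, the parent settled four in both directions (`{rootS, K_S1}`, `{holeS, farSWS}` and mirrors). This file settles the
other twelve: the four DEAD-DOOR cells `{holeS | rootS} × {holeSS, rootSS}` (under) with their mirrors, and the two EAST cells
`{rootS} × {pocketSE, rootE}` (under) with their mirrors — each as a box-level biconditional, the emptiness being a FLOOR /
CEILING effect (exactly three rows) resp. an EAST-WALL effect (exactly two columns beyond the root plaquette):

* §1 SIX UNMARKED WOUND WITNESSES (30–34 arcs, every rhombus one arc ⇒ `w₁`-free and `w₂`-free off the far cell) from the lane's
  constructive generator, kernel-certified at the reference position, transported to every position: `sharpBlockDH` (under,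
  avoids `holeS, holeSS, rootSS`; cells in `[1,6]×[−2,3]`), `sharpBlockDR` (under, avoids `rootS, holeSS, rootSS`; same frame),
  `sharpBlockEP` (under, avoids `rootS, pocketSE, rootE`; `[1,7]×[−1,4]`) and the row mirrors `DHN`, `DRN`, `EPN` (over).
* §2 ★★ `lawL_box_oneLiveRowN3_not_wound_over` — the missing TOP TWIN of the one-live-row box theorem: `h.2 + 4 = n`, the door
  `holeN | rootN` dead and the side above it dead ⇒ no wound over-walk (from `ΩG.WE_eq_excursionWinding_of_over_oneLiveRowN`);
  placement under a three-cell defect list `block_hroot_subset_boxMinus_triple`.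
* §3 ★★★★★ THE BICONDITIONALS (defect lists `S ∋ h` inside the four-cell set named, containing the door cell and one cell behind):
  `lawL_box_holeS_doorBelow_not_wound_under_iff` / `lawL_box_rootS_doorBelow_not_wound_under_iff` — `2 ≤ h.1`, `h.1 + 4 ≤ m`,
  `3 ≤ h.2`, `h.2 + 2 ≤ n`: NO wound under-walk ⟺ `h.2 = 3`; `lawL_box_holeN_doorAbove_not_wound_over_iff` /
  `lawL_box_rootN_doorAbove_not_wound_over_iff` — ⟺ `h.2 + 4 = n`; `lawL_box_rootS_eastPair_not_wound_under_iff` — `2 ≤ h.1`,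
  `h.1 + 4 ≤ m`, `3 ≤ h.2`, `h.2 + 3 ≤ n`, `rootS` and `pocketSE | rootE` removed: NO wound under-walk ⟺ `h.1 + 4 = m`;
  `lawL_box_rootN_eastPair_not_wound_over_iff` — the mirror. Together with the parent: ALL SIXTEEN empty route-cells of the census
  are wall effects with an exact threshold, and off the threshold the route carries a wound walk free in both classes.

Not in print; venture lane «pcv-sawmu», seat b-step0 gen 30 (generator `HOME/code/step0/g30/gen/wgen.py`, witnesses `car3_witnesses.json`).

References: A. Glazman, I. Manolescu, arXiv:1708.00395v3, §1 (Fig. 1, Fig. 2, remark after eq. (1)), §2.1, §4.2 (translation invariance,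
lattice symmetries), Lemma 2.1 [GlazmanManolescu2019]; A. Glazman, Electron. Commun. Probab. 20 (2015) no. 86, Lemma 3.1, proof pp. 6–7
[Glazman2015WeightedSAW]; R. Courant, H. Robbins, *What is Mathematics?* (1941/1958), Ch. V Appendix §2 (the even–odd rule) [CourantRobbins1958].
-/

noncomputable section

open Set Function Complex

namespace Literature.Barriers.CriticalPhenomena.PlaquetteWalk

open Literature.Probability.RandomPlanarGeometry.SAW.YangBaxter
open Real Complex

/-! ## §1 Six unmarked wound witnesses (reference root `w42 = (4, 2)`, hole `(3, 2)`, far cell `(2, 2)`), every position -/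

section Witnesses

/-- Sharpness witness block `DH`: the 30 cells of an under wound witness, UNMARKED (one arc per rhombus: `w₁`-free AND
`w₂`-free off the far cell), reference root `(4, 2)`, hole `(3, 2)`, far cell `(2, 2)`, AVOIDING `holeS = (3,1)`, `holeSS = (3,0)`, `rootSS = (4,0)`; cells in `[1,6]×[−2,3]`
(constructive generator `wgen.py` of the lane, seat b-step0 gen 30). [cite: GlazmanManolescu2019, §2.1 (finite domains of faces)] -/
def sharpBlockDH42 : List Face :=
  [(1,-2),(1,-1),(1,0),(1,1),(1,2),(2,-2),(2,-1),(2,0),(2,1),(2,2),(2,3),(3,-2),(3,-1),(3,3),(4,-2),(4,-1),(4,1),(4,2),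
  (4,3),(5,-2),(5,-1),(5,0),(5,1),(5,2),(5,3),(6,-2),(6,-1),(6,0),(6,1),(6,2)]

/-- Its mid-edges (30 arcs). [cite: GlazmanManolescu2019, §1 (definition of the model), Fig. 1] -/
def sharpDHMids : List MidEdge :=
  [.vert 4 2, .slant 4 2, .vert 5 1, .slant 5 1, .slant 5 0, .vert 5 (-1), .vert 4 (-1), .vert 3 (-1), .slant 2 0,
  .slant 2 1, .slant 2 2, .vert 2 2, .slant 1 2, .slant 1 1, .slant 1 0, .slant 1 (-1), .vert 2 (-2), .vert 3 (-2),
  .vert 4 (-2), .vert 5 (-2), .vert 6 (-2), .slant 6 (-1), .slant 6 0, .slant 6 1, .slant 6 2, .vert 6 2, .slant 5 3,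
  .vert 5 3, .vert 4 3, .vert 3 3, .slant 2 3]

/-- The witness as a walk of its block. [cite: GlazmanManolescu2019, §1 (definition of the model), Fig. 1] -/
def sharpDHWalk : YBWalk (dom sharpBlockDH42) (w42.side .W) ((farW w42).side .N) where
  mids := sharpDHMids
  head_eq := by decide
  getLast_eq := by decide
  nodup := by decide
  arc_mem := arc_mem_of_check (by decide)
  isChain := by decide
  noncross := noncross_of_check (by decide)

/-- The labelled witness. [cite: Glazman2015WeightedSAW, Lemma 3.1 (proof, pp. 6–7)] -/
def ωsharpDH : ΩG (dom sharpBlockDH42) (w42.side .W) (farW w42) := ⟨.N, sharpDHWalk⟩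

/-- Certificates: first hit `10`, `30` arcs, no later far-cell arc, first side `S`, `w₁`-free and `w₂`-free off the far
cell, odd eastern-ray count. [cite: Glazman2015WeightedSAW, Lemma 3.1 (proof, pp. 6–7)] [cite: CourantRobbins1958, Ch. V Appendix §2 (the even–odd rule)] -/
theorem ωsharpDH_cert : ωsharpDH.2.firstHitG = 10 ∧ ωsharpDH.2.arcs.length = 30 ∧
    (∀ j < 30, 10 < j → ωsharpDH.2.fc j ≠ farW w42) ∧ ωsharpDH.2.nth 10 = (farW w42).side .S ∧
    (ωsharpDH.2.W1FreeOff (farW w42) ∧ ωsharpDH.2.W2FreeOff (farW w42)) ∧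
    Odd ((Finset.range 20).filter fun j => eastRayB w42 (ωsharpDH.2.nth (10 + j + 1)) = true).card := by
  refine ⟨by decide, by decide, by decide, by decide, ⟨by unfold YBWalk.W1FreeOff; decide, by unfold YBWalk.W2FreeOff; decide⟩,
    by decide⟩

/-- The block at the root plaquette `w`. [cite: GlazmanManolescu2019, §2.1, §4.2 (translation invariance)] -/
def sharpBlockDH (w : Face) : List Face := sharpBlockDH42.map (Face.shiftBy (refShift w))

/-- ★★★ The unmarked under wound witness `DH` at EVERY POSITION: any face list containing the translated block carries a
wound class-`B2a` under-walk at the far cell, `w₁`-free and `w₂`-free off it.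
[cite: GlazmanManolescu2019, §4.2 (translation invariance), Lemma 2.1]
[cite: Glazman2015WeightedSAW, Lemma 3.1 (proof, pp. 6–7)] [cite: CourantRobbins1958, Ch. V Appendix §2 (the even–odd rule)] -/
theorem exists_under_unmarked_of_sharpBlockDH {Dl : List Face} {w : Face} (hB : ∀ c ∈ sharpBlockDH w, c ∈ Dl)
    (hr : RootedFace (dom Dl) (w.side .W) (farW w)) (θ : ℝ) :
    ∃ (ω : ΩG (dom Dl) (w.side .W) (farW w)) (h : ω.IsB2a), ω.2.firstSideG = .S ∧
      ω.WE (fun _ => θ) ≠ excursionWinding θ ω.2.firstSideG (ω.z1 hr h) ω.1 ∧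
        (ω.2.W1FreeOff (farW w) ∧ ω.2.W2FreeOff (farW w)) := by
  have hB₀ := block42_mem_of_block_mem (B := sharpBlockDH42) hB
  obtain ⟨hF, hn, hfc, hnth, hfree, hodd⟩ := ωsharpDH_cert
  let ω₀ : ΩG (dom (Dl.map (Face.shiftBy (-refShift w)))) (w42.side .W) (farW w42) :=
    ⟨.N, sharpDHWalk.mapDomain fun c hc => hB₀ c hc⟩
  have hF' : ω₀.2.firstHitG = 10 := hF
  have hn' : ω₀.2.arcs.length = 30 := hn
  have h₀ : ω₀.IsB2a := by
    refine ΩG.isB2a_of_forall_fc_ne (by rw [hF', hn']; omega) fun j hj1 hj2 => ?_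
    rw [hF'] at hj1
    rw [hn'] at hj2
    exact hfc j hj2 hj1
  have hM : ω₀.Mv = 20 := by unfold ΩG.Mv; rw [hF', hn']
  exact exists_wound_witness_shift (shiftBy_refShift_root w) (shiftBy_refShift_farW w) hr
    (fun γ r => γ.W1FreeOff r ∧ γ.W2FreeOff r)
    (fun hm _ hf => ⟨YBWalk.W1FreeOff_of_mids_shift hm hf.1, YBWalk.W2FreeOff_of_mids_shift hm hf.2⟩) ω₀ h₀
    (by rw [hF']; exact hnth) hfree (by rw [hM, hF']; exact hodd) θ

/-- Sharpness witness block `DR`: the 30 cells of an under wound witness, UNMARKED (one arc per rhombus: `w₁`-free AND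
`w₂`-free off the far cell), reference root `(4, 2)`, hole `(3, 2)`, far cell `(2, 2)`, AVOIDING `rootS = (4,1)`, `holeSS = (3,0)`, `rootSS = (4,0)`; cells in `[1,6]×[−2,3]`
(constructive generator `wgen.py` of the lane, seat b-step0 gen 30). [cite: GlazmanManolescu2019, §2.1 (finite domains of faces)] -/
def sharpBlockDR42 : List Face :=
  [(1,-2),(1,-1),(1,0),(1,1),(1,2),(2,-2),(2,-1),(2,0),(2,1),(2,2),(2,3),(3,-2),(3,-1),(3,3),(4,-2),(4,-1),(4,2),(4,3),
  (5,-2),(5,-1),(5,0),(5,1),(5,2),(5,3),(6,-2),(6,-1),(6,0),(6,1),(6,2),(6,3)]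

/-- Its mid-edges (30 arcs). [cite: GlazmanManolescu2019, §1 (definition of the model), Fig. 1] -/
def sharpDRMids : List MidEdge :=
  [.vert 4 2, .vert 5 2, .slant 5 2, .slant 5 1, .slant 5 0, .vert 5 (-1), .vert 4 (-1), .vert 3 (-1), .slant 2 0,
  .slant 2 1, .slant 2 2, .vert 2 2, .slant 1 2, .slant 1 1, .slant 1 0, .slant 1 (-1), .vert 2 (-2), .vert 3 (-2),
  .vert 4 (-2), .vert 5 (-2), .vert 6 (-2), .slant 6 (-1), .slant 6 0, .slant 6 1, .slant 6 2, .slant 6 3, .vert 6 3,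
  .vert 5 3, .vert 4 3, .vert 3 3, .slant 2 3]

/-- The witness as a walk of its block. [cite: GlazmanManolescu2019, §1 (definition of the model), Fig. 1] -/
def sharpDRWalk : YBWalk (dom sharpBlockDR42) (w42.side .W) ((farW w42).side .N) where
  mids := sharpDRMids
  head_eq := by decide
  getLast_eq := by decide
  nodup := by decide
  arc_mem := arc_mem_of_check (by decide)
  isChain := by decide
  noncross := noncross_of_check (by decide)

/-- The labelled witness. [cite: Glazman2015WeightedSAW, Lemma 3.1 (proof, pp. 6–7)] -/
def ωsharpDR : ΩG (dom sharpBlockDR42) (w42.side .W) (farW w42) := ⟨.N, sharpDRWalk⟩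

/-- Certificates: first hit `10`, `30` arcs, no later far-cell arc, first side `S`, `w₁`-free and `w₂`-free off the far
cell, odd eastern-ray count. [cite: Glazman2015WeightedSAW, Lemma 3.1 (proof, pp. 6–7)] [cite: CourantRobbins1958, Ch. V Appendix §2 (the even–odd rule)] -/
theorem ωsharpDR_cert : ωsharpDR.2.firstHitG = 10 ∧ ωsharpDR.2.arcs.length = 30 ∧
    (∀ j < 30, 10 < j → ωsharpDR.2.fc j ≠ farW w42) ∧ ωsharpDR.2.nth 10 = (farW w42).side .S ∧
    (ωsharpDR.2.W1FreeOff (farW w42) ∧ ωsharpDR.2.W2FreeOff (farW w42)) ∧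
    Odd ((Finset.range 20).filter fun j => eastRayB w42 (ωsharpDR.2.nth (10 + j + 1)) = true).card := by
  refine ⟨by decide, by decide, by decide, by decide, ⟨by unfold YBWalk.W1FreeOff; decide, by unfold YBWalk.W2FreeOff; decide⟩,
    by decide⟩

/-- The block at the root plaquette `w`. [cite: GlazmanManolescu2019, §2.1, §4.2 (translation invariance)] -/
def sharpBlockDR (w : Face) : List Face := sharpBlockDR42.map (Face.shiftBy (refShift w))

/-- ★★★ The unmarked under wound witness `DR` at EVERY POSITION: any face list containing the translated block carries a
wound class-`B2a` under-walk at the far cell, `w₁`-free and `w₂`-free off it.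
[cite: GlazmanManolescu2019, §4.2 (translation invariance), Lemma 2.1]
[cite: Glazman2015WeightedSAW, Lemma 3.1 (proof, pp. 6–7)] [cite: CourantRobbins1958, Ch. V Appendix §2 (the even–odd rule)] -/
theorem exists_under_unmarked_of_sharpBlockDR {Dl : List Face} {w : Face} (hB : ∀ c ∈ sharpBlockDR w, c ∈ Dl)
    (hr : RootedFace (dom Dl) (w.side .W) (farW w)) (θ : ℝ) :
    ∃ (ω : ΩG (dom Dl) (w.side .W) (farW w)) (h : ω.IsB2a), ω.2.firstSideG = .S ∧
      ω.WE (fun _ => θ) ≠ excursionWinding θ ω.2.firstSideG (ω.z1 hr h) ω.1 ∧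
        (ω.2.W1FreeOff (farW w) ∧ ω.2.W2FreeOff (farW w)) := by
  have hB₀ := block42_mem_of_block_mem (B := sharpBlockDR42) hB
  obtain ⟨hF, hn, hfc, hnth, hfree, hodd⟩ := ωsharpDR_cert
  let ω₀ : ΩG (dom (Dl.map (Face.shiftBy (-refShift w)))) (w42.side .W) (farW w42) :=
    ⟨.N, sharpDRWalk.mapDomain fun c hc => hB₀ c hc⟩
  have hF' : ω₀.2.firstHitG = 10 := hF
  have hn' : ω₀.2.arcs.length = 30 := hn
  have h₀ : ω₀.IsB2a := by
    refine ΩG.isB2a_of_forall_fc_ne (by rw [hF', hn']; omega) fun j hj1 hj2 => ?_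
    rw [hF'] at hj1
    rw [hn'] at hj2
    exact hfc j hj2 hj1
  have hM : ω₀.Mv = 20 := by unfold ΩG.Mv; rw [hF', hn']
  exact exists_wound_witness_shift (shiftBy_refShift_root w) (shiftBy_refShift_farW w) hr
    (fun γ r => γ.W1FreeOff r ∧ γ.W2FreeOff r)
    (fun hm _ hf => ⟨YBWalk.W1FreeOff_of_mids_shift hm hf.1, YBWalk.W2FreeOff_of_mids_shift hm hf.2⟩) ω₀ h₀
    (by rw [hF']; exact hnth) hfree (by rw [hM, hF']; exact hodd) θ

/-- Sharpness witness block `EP`: the 34 cells of an under wound witness, UNMARKED (one arc per rhombus: `w₁`-free AND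
`w₂`-free off the far cell), reference root `(4, 2)`, hole `(3, 2)`, far cell `(2, 2)`, AVOIDING `rootS = (4,1)`, `pocketSE = (5,1)`, `rootE = (5,2)`; cells in `[1,7]×[−1,4]`
(constructive generator `wgen.py` of the lane, seat b-step0 gen 30). [cite: GlazmanManolescu2019, §2.1 (finite domains of faces)] -/
def sharpBlockEP42 : List Face :=
  [(1,-1),(1,0),(1,1),(1,2),(2,-1),(2,0),(2,1),(2,2),(2,3),(2,4),(3,-1),(3,0),(3,4),(4,-1),(4,0),(4,2),(4,3),(4,4),
  (5,-1),(5,0),(5,3),(5,4),(6,-1),(6,0),(6,1),(6,2),(6,3),(6,4),(7,-1),(7,0),(7,1),(7,2),(7,3),(7,4)]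

/-- Its mid-edges (34 arcs). [cite: GlazmanManolescu2019, §1 (definition of the model), Fig. 1] -/
def sharpEPMids : List MidEdge :=
  [.vert 4 2, .slant 4 3, .vert 5 3, .vert 6 3, .slant 6 3, .slant 6 2, .slant 6 1, .vert 6 0, .vert 5 0, .vert 4 0,
  .vert 3 0, .slant 2 1, .slant 2 2, .vert 2 2, .slant 1 2, .slant 1 1, .slant 1 0, .vert 2 (-1), .vert 3 (-1),
  .vert 4 (-1), .vert 5 (-1), .vert 6 (-1), .vert 7 (-1), .slant 7 0, .slant 7 1, .slant 7 2, .slant 7 3, .slant 7 4,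
  .vert 7 4, .vert 6 4, .vert 5 4, .vert 4 4, .vert 3 4, .slant 2 4, .slant 2 3]

/-- The witness as a walk of its block. [cite: GlazmanManolescu2019, §1 (definition of the model), Fig. 1] -/
def sharpEPWalk : YBWalk (dom sharpBlockEP42) (w42.side .W) ((farW w42).side .N) where
  mids := sharpEPMids
  head_eq := by decide
  getLast_eq := by decide
  nodup := by decide
  arc_mem := arc_mem_of_check (by decide)
  isChain := by decide
  noncross := noncross_of_check (by decide)

/-- The labelled witness. [cite: Glazman2015WeightedSAW, Lemma 3.1 (proof, pp. 6–7)] -/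
def ωsharpEP : ΩG (dom sharpBlockEP42) (w42.side .W) (farW w42) := ⟨.N, sharpEPWalk⟩

/-- Certificates: first hit `12`, `34` arcs, no later far-cell arc, first side `S`, `w₁`-free and `w₂`-free off the far
cell, odd eastern-ray count. [cite: Glazman2015WeightedSAW, Lemma 3.1 (proof, pp. 6–7)] [cite: CourantRobbins1958, Ch. V Appendix §2 (the even–odd rule)] -/
theorem ωsharpEP_cert : ωsharpEP.2.firstHitG = 12 ∧ ωsharpEP.2.arcs.length = 34 ∧
    (∀ j < 34, 12 < j → ωsharpEP.2.fc j ≠ farW w42) ∧ ωsharpEP.2.nth 12 = (farW w42).side .S ∧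
    (ωsharpEP.2.W1FreeOff (farW w42) ∧ ωsharpEP.2.W2FreeOff (farW w42)) ∧
    Odd ((Finset.range 22).filter fun j => eastRayB w42 (ωsharpEP.2.nth (12 + j + 1)) = true).card := by
  refine ⟨by decide, by decide, by decide, by decide, ⟨by unfold YBWalk.W1FreeOff; decide, by unfold YBWalk.W2FreeOff; decide⟩,
    by decide⟩

/-- The block at the root plaquette `w`. [cite: GlazmanManolescu2019, §2.1, §4.2 (translation invariance)] -/
def sharpBlockEP (w : Face) : List Face := sharpBlockEP42.map (Face.shiftBy (refShift w))

/-- ★★★ The unmarked under wound witness `EP` at EVERY POSITION: any face list containing the translated block carries a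
wound class-`B2a` under-walk at the far cell, `w₁`-free and `w₂`-free off it.
[cite: GlazmanManolescu2019, §4.2 (translation invariance), Lemma 2.1]
[cite: Glazman2015WeightedSAW, Lemma 3.1 (proof, pp. 6–7)] [cite: CourantRobbins1958, Ch. V Appendix §2 (the even–odd rule)] -/
theorem exists_under_unmarked_of_sharpBlockEP {Dl : List Face} {w : Face} (hB : ∀ c ∈ sharpBlockEP w, c ∈ Dl)
    (hr : RootedFace (dom Dl) (w.side .W) (farW w)) (θ : ℝ) :
    ∃ (ω : ΩG (dom Dl) (w.side .W) (farW w)) (h : ω.IsB2a), ω.2.firstSideG = .S ∧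
      ω.WE (fun _ => θ) ≠ excursionWinding θ ω.2.firstSideG (ω.z1 hr h) ω.1 ∧
        (ω.2.W1FreeOff (farW w) ∧ ω.2.W2FreeOff (farW w)) := by
  have hB₀ := block42_mem_of_block_mem (B := sharpBlockEP42) hB
  obtain ⟨hF, hn, hfc, hnth, hfree, hodd⟩ := ωsharpEP_cert
  let ω₀ : ΩG (dom (Dl.map (Face.shiftBy (-refShift w)))) (w42.side .W) (farW w42) :=
    ⟨.N, sharpEPWalk.mapDomain fun c hc => hB₀ c hc⟩
  have hF' : ω₀.2.firstHitG = 12 := hF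
  have hn' : ω₀.2.arcs.length = 34 := hn
  have h₀ : ω₀.IsB2a := by
    refine ΩG.isB2a_of_forall_fc_ne (by rw [hF', hn']; omega) fun j hj1 hj2 => ?_
    rw [hF'] at hj1
    rw [hn'] at hj2
    exact hfc j hj2 hj1
  have hM : ω₀.Mv = 22 := by unfold ΩG.Mv; rw [hF', hn']
  exact exists_wound_witness_shift (shiftBy_refShift_root w) (shiftBy_refShift_farW w) hr
    (fun γ r => γ.W1FreeOff r ∧ γ.W2FreeOff r)
    (fun hm _ hf => ⟨YBWalk.W1FreeOff_of_mids_shift hm hf.1, YBWalk.W2FreeOff_of_mids_shift hm hf.2⟩) ω₀ h₀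
    (by rw [hF']; exact hnth) hfree (by rw [hM, hF']; exact hodd) θ

/-- Sharpness witness block `DHN`: the 30 cells of an over wound witness, UNMARKED (one arc per rhombus: `w₁`-free AND
`w₂`-free off the far cell), reference root `(4, 2)`, hole `(3, 2)`, far cell `(2, 2)`, AVOIDING `holeN = (3,3)`, `holeNN = (3,4)`, `rootNN = (4,4)` (row mirror of `DH`); cells in `[1,6]×[1,6]`
(constructive generator `wgen.py` of the lane, seat b-step0 gen 30). [cite: GlazmanManolescu2019, §2.1 (finite domains of faces)] -/
def sharpBlockDHN42 : List Face :=
  [(1,2),(1,3),(1,4),(1,5),(1,6),(2,1),(2,2),(2,3),(2,4),(2,5),(2,6),(3,1),(3,5),(3,6),(4,1),(4,2),(4,3),(4,5),(4,6),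
  (5,1),(5,2),(5,3),(5,4),(5,5),(5,6),(6,2),(6,3),(6,4),(6,5),(6,6)]

/-- Its mid-edges (30 arcs). [cite: GlazmanManolescu2019, §1 (definition of the model), Fig. 1] -/
def sharpDHNMids : List MidEdge :=
  [.vert 4 2, .slant 4 3, .vert 5 3, .slant 5 4, .slant 5 5, .vert 5 5, .vert 4 5, .vert 3 5, .slant 2 5, .slant 2 4,
  .slant 2 3, .vert 2 2, .slant 1 3, .slant 1 4, .slant 1 5, .slant 1 6, .vert 2 6, .vert 3 6, .vert 4 6, .vert 5 6,
  .vert 6 6, .slant 6 6, .slant 6 5, .slant 6 4, .slant 6 3, .vert 6 2, .slant 5 2, .vert 5 1, .vert 4 1, .vert 3 1,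
  .slant 2 2]

/-- The witness as a walk of its block. [cite: GlazmanManolescu2019, §1 (definition of the model), Fig. 1] -/
def sharpDHNWalk : YBWalk (dom sharpBlockDHN42) (w42.side .W) ((farW w42).side .S) where
  mids := sharpDHNMids
  head_eq := by decide
  getLast_eq := by decide
  nodup := by decide
  arc_mem := arc_mem_of_check (by decide)
  isChain := by decide
  noncross := noncross_of_check (by decide)

/-- The labelled witness. [cite: Glazman2015WeightedSAW, Lemma 3.1 (proof, pp. 6–7)] -/
def ωsharpDHN : ΩG (dom sharpBlockDHN42) (w42.side .W) (farW w42) := ⟨.S, sharpDHNWalk⟩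

/-- Certificates: first hit `10`, `30` arcs, no later far-cell arc, first side `N`, `w₁`-free and `w₂`-free off the far
cell, odd eastern-ray count. [cite: Glazman2015WeightedSAW, Lemma 3.1 (proof, pp. 6–7)] [cite: CourantRobbins1958, Ch. V Appendix §2 (the even–odd rule)] -/
theorem ωsharpDHN_cert : ωsharpDHN.2.firstHitG = 10 ∧ ωsharpDHN.2.arcs.length = 30 ∧
    (∀ j < 30, 10 < j → ωsharpDHN.2.fc j ≠ farW w42) ∧ ωsharpDHN.2.nth 10 = (farW w42).side .N ∧
    (ωsharpDHN.2.W1FreeOff (farW w42) ∧ ωsharpDHN.2.W2FreeOff (farW w42)) ∧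
    Odd ((Finset.range 20).filter fun j => eastRayB w42 (ωsharpDHN.2.nth (10 + j + 1)) = true).card := by
  refine ⟨by decide, by decide, by decide, by decide, ⟨by unfold YBWalk.W1FreeOff; decide, by unfold YBWalk.W2FreeOff; decide⟩,
    by decide⟩

/-- The block at the root plaquette `w`. [cite: GlazmanManolescu2019, §2.1, §4.2 (translation invariance)] -/
def sharpBlockDHN (w : Face) : List Face := sharpBlockDHN42.map (Face.shiftBy (refShift w))

/-- ★★★ The unmarked over wound witness `DHN` at EVERY POSITION: any face list containing the translated block carries a
wound class-`B2a` over-walk at the far cell, `w₁`-free and `w₂`-free off it.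
[cite: GlazmanManolescu2019, §4.2 (translation invariance), Lemma 2.1]
[cite: Glazman2015WeightedSAW, Lemma 3.1 (proof, pp. 6–7)] [cite: CourantRobbins1958, Ch. V Appendix §2 (the even–odd rule)] -/
theorem exists_over_unmarked_of_sharpBlockDHN {Dl : List Face} {w : Face} (hB : ∀ c ∈ sharpBlockDHN w, c ∈ Dl)
    (hr : RootedFace (dom Dl) (w.side .W) (farW w)) (θ : ℝ) :
    ∃ (ω : ΩG (dom Dl) (w.side .W) (farW w)) (h : ω.IsB2a), ω.2.firstSideG = .N ∧
      ω.WE (fun _ => θ) ≠ excursionWinding θ ω.2.firstSideG (ω.z1 hr h) ω.1 ∧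
        (ω.2.W1FreeOff (farW w) ∧ ω.2.W2FreeOff (farW w)) := by
  have hB₀ := block42_mem_of_block_mem (B := sharpBlockDHN42) hB
  obtain ⟨hF, hn, hfc, hnth, hfree, hodd⟩ := ωsharpDHN_cert
  let ω₀ : ΩG (dom (Dl.map (Face.shiftBy (-refShift w)))) (w42.side .W) (farW w42) :=
    ⟨.S, sharpDHNWalk.mapDomain fun c hc => hB₀ c hc⟩
  have hF' : ω₀.2.firstHitG = 10 := hF
  have hn' : ω₀.2.arcs.length = 30 := hn
  have h₀ : ω₀.IsB2a := by
    refine ΩG.isB2a_of_forall_fc_ne (by rw [hF', hn']; omega) fun j hj1 hj2 => ?_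
    rw [hF'] at hj1
    rw [hn'] at hj2
    exact hfc j hj2 hj1
  have hM : ω₀.Mv = 20 := by unfold ΩG.Mv; rw [hF', hn']
  exact exists_wound_witness_shift (shiftBy_refShift_root w) (shiftBy_refShift_farW w) hr
    (fun γ r => γ.W1FreeOff r ∧ γ.W2FreeOff r)
    (fun hm _ hf => ⟨YBWalk.W1FreeOff_of_mids_shift hm hf.1, YBWalk.W2FreeOff_of_mids_shift hm hf.2⟩) ω₀ h₀
    (by rw [hF']; exact hnth) hfree (by rw [hM, hF']; exact hodd) θ

/-- Sharpness witness block `DRN`: the 30 cells of an over wound witness, UNMARKED (one arc per rhombus: `w₁`-free AND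
`w₂`-free off the far cell), reference root `(4, 2)`, hole `(3, 2)`, far cell `(2, 2)`, AVOIDING `rootN = (4,3)`, `holeNN = (3,4)`, `rootNN = (4,4)` (row mirror of `DR`); cells in `[1,6]×[1,6]`
(constructive generator `wgen.py` of the lane, seat b-step0 gen 30). [cite: GlazmanManolescu2019, §2.1 (finite domains of faces)] -/
def sharpBlockDRN42 : List Face :=
  [(1,2),(1,3),(1,4),(1,5),(1,6),(2,1),(2,2),(2,3),(2,4),(2,5),(2,6),(3,1),(3,5),(3,6),(4,1),(4,2),(4,5),(4,6),(5,1),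
  (5,2),(5,3),(5,4),(5,5),(5,6),(6,1),(6,2),(6,3),(6,4),(6,5),(6,6)]

/-- Its mid-edges (30 arcs). [cite: GlazmanManolescu2019, §1 (definition of the model), Fig. 1] -/
def sharpDRNMids : List MidEdge :=
  [.vert 4 2, .vert 5 2, .slant 5 3, .slant 5 4, .slant 5 5, .vert 5 5, .vert 4 5, .vert 3 5, .slant 2 5, .slant 2 4,
  .slant 2 3, .vert 2 2, .slant 1 3, .slant 1 4, .slant 1 5, .slant 1 6, .vert 2 6, .vert 3 6, .vert 4 6, .vert 5 6,
  .vert 6 6, .slant 6 6, .slant 6 5, .slant 6 4, .slant 6 3, .slant 6 2, .vert 6 1, .vert 5 1, .vert 4 1, .vert 3 1,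
  .slant 2 2]

/-- The witness as a walk of its block. [cite: GlazmanManolescu2019, §1 (definition of the model), Fig. 1] -/
def sharpDRNWalk : YBWalk (dom sharpBlockDRN42) (w42.side .W) ((farW w42).side .S) where
  mids := sharpDRNMids
  head_eq := by decide
  getLast_eq := by decide
  nodup := by decide
  arc_mem := arc_mem_of_check (by decide)
  isChain := by decide
  noncross := noncross_of_check (by decide)

/-- The labelled witness. [cite: Glazman2015WeightedSAW, Lemma 3.1 (proof, pp. 6–7)] -/
def ωsharpDRN : ΩG (dom sharpBlockDRN42) (w42.side .W) (farW w42) := ⟨.S, sharpDRNWalk⟩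

/-- Certificates: first hit `10`, `30` arcs, no later far-cell arc, first side `N`, `w₁`-free and `w₂`-free off the far
cell, odd eastern-ray count. [cite: Glazman2015WeightedSAW, Lemma 3.1 (proof, pp. 6–7)] [cite: CourantRobbins1958, Ch. V Appendix §2 (the even–odd rule)] -/
theorem ωsharpDRN_cert : ωsharpDRN.2.firstHitG = 10 ∧ ωsharpDRN.2.arcs.length = 30 ∧
    (∀ j < 30, 10 < j → ωsharpDRN.2.fc j ≠ farW w42) ∧ ωsharpDRN.2.nth 10 = (farW w42).side .N ∧
    (ωsharpDRN.2.W1FreeOff (farW w42) ∧ ωsharpDRN.2.W2FreeOff (farW w42)) ∧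
    Odd ((Finset.range 20).filter fun j => eastRayB w42 (ωsharpDRN.2.nth (10 + j + 1)) = true).card := by
  refine ⟨by decide, by decide, by decide, by decide, ⟨by unfold YBWalk.W1FreeOff; decide, by unfold YBWalk.W2FreeOff; decide⟩,
    by decide⟩

/-- The block at the root plaquette `w`. [cite: GlazmanManolescu2019, §2.1, §4.2 (translation invariance)] -/
def sharpBlockDRN (w : Face) : List Face := sharpBlockDRN42.map (Face.shiftBy (refShift w))

/-- ★★★ The unmarked over wound witness `DRN` at EVERY POSITION: any face list containing the translated block carries a
wound class-`B2a` over-walk at the far cell, `w₁`-free and `w₂`-free off it.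
[cite: GlazmanManolescu2019, §4.2 (translation invariance), Lemma 2.1]
[cite: Glazman2015WeightedSAW, Lemma 3.1 (proof, pp. 6–7)] [cite: CourantRobbins1958, Ch. V Appendix §2 (the even–odd rule)] -/
theorem exists_over_unmarked_of_sharpBlockDRN {Dl : List Face} {w : Face} (hB : ∀ c ∈ sharpBlockDRN w, c ∈ Dl)
    (hr : RootedFace (dom Dl) (w.side .W) (farW w)) (θ : ℝ) :
    ∃ (ω : ΩG (dom Dl) (w.side .W) (farW w)) (h : ω.IsB2a), ω.2.firstSideG = .N ∧
      ω.WE (fun _ => θ) ≠ excursionWinding θ ω.2.firstSideG (ω.z1 hr h) ω.1 ∧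
        (ω.2.W1FreeOff (farW w) ∧ ω.2.W2FreeOff (farW w)) := by
  have hB₀ := block42_mem_of_block_mem (B := sharpBlockDRN42) hB
  obtain ⟨hF, hn, hfc, hnth, hfree, hodd⟩ := ωsharpDRN_cert
  let ω₀ : ΩG (dom (Dl.map (Face.shiftBy (-refShift w)))) (w42.side .W) (farW w42) :=
    ⟨.S, sharpDRNWalk.mapDomain fun c hc => hB₀ c hc⟩
  have hF' : ω₀.2.firstHitG = 10 := hF
  have hn' : ω₀.2.arcs.length = 30 := hn
  have h₀ : ω₀.IsB2a := by
    refine ΩG.isB2a_of_forall_fc_ne (by rw [hF', hn']; omega) fun j hj1 hj2 => ?_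
    rw [hF'] at hj1
    rw [hn'] at hj2
    exact hfc j hj2 hj1
  have hM : ω₀.Mv = 20 := by unfold ΩG.Mv; rw [hF', hn']
  exact exists_wound_witness_shift (shiftBy_refShift_root w) (shiftBy_refShift_farW w) hr
    (fun γ r => γ.W1FreeOff r ∧ γ.W2FreeOff r)
    (fun hm _ hf => ⟨YBWalk.W1FreeOff_of_mids_shift hm hf.1, YBWalk.W2FreeOff_of_mids_shift hm hf.2⟩) ω₀ h₀
    (by rw [hF']; exact hnth) hfree (by rw [hM, hF']; exact hodd) θ

/-- Sharpness witness block `EPN`: the 34 cells of an over wound witness, UNMARKED (one arc per rhombus: `w₁`-free AND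
`w₂`-free off the far cell), reference root `(4, 2)`, hole `(3, 2)`, far cell `(2, 2)`, AVOIDING `rootN = (4,3)`, `pocketNE = (5,3)`, `rootE = (5,2)` (row mirror of `EP`); cells in `[1,7]×[0,5]`
(constructive generator `wgen.py` of the lane, seat b-step0 gen 30). [cite: GlazmanManolescu2019, §2.1 (finite domains of faces)] -/
def sharpBlockEPN42 : List Face :=
  [(1,2),(1,3),(1,4),(1,5),(2,0),(2,1),(2,2),(2,3),(2,4),(2,5),(3,0),(3,4),(3,5),(4,0),(4,1),(4,2),(4,4),(4,5),(5,0),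
  (5,1),(5,4),(5,5),(6,0),(6,1),(6,2),(6,3),(6,4),(6,5),(7,0),(7,1),(7,2),(7,3),(7,4),(7,5)]

/-- Its mid-edges (34 arcs). [cite: GlazmanManolescu2019, §1 (definition of the model), Fig. 1] -/
def sharpEPNMids : List MidEdge :=
  [.vert 4 2, .slant 4 2, .vert 5 1, .vert 6 1, .slant 6 2, .slant 6 3, .slant 6 4, .vert 6 4, .vert 5 4, .vert 4 4,
  .vert 3 4, .slant 2 4, .slant 2 3, .vert 2 2, .slant 1 3, .slant 1 4, .slant 1 5, .vert 2 5, .vert 3 5, .vert 4 5,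
  .vert 5 5, .vert 6 5, .vert 7 5, .slant 7 5, .slant 7 4, .slant 7 3, .slant 7 2, .slant 7 1, .vert 7 0, .vert 6 0,
  .vert 5 0, .vert 4 0, .vert 3 0, .slant 2 1, .slant 2 2]

/-- The witness as a walk of its block. [cite: GlazmanManolescu2019, §1 (definition of the model), Fig. 1] -/
def sharpEPNWalk : YBWalk (dom sharpBlockEPN42) (w42.side .W) ((farW w42).side .S) where
  mids := sharpEPNMids
  head_eq := by decide
  getLast_eq := by decide
  nodup := by decide
  arc_mem := arc_mem_of_check (by decide)
  isChain := by decide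
  noncross := noncross_of_check (by decide)

/-- The labelled witness. [cite: Glazman2015WeightedSAW, Lemma 3.1 (proof, pp. 6–7)] -/
def ωsharpEPN : ΩG (dom sharpBlockEPN42) (w42.side .W) (farW w42) := ⟨.S, sharpEPNWalk⟩

/-- Certificates: first hit `12`, `34` arcs, no later far-cell arc, first side `N`, `w₁`-free and `w₂`-free off the far
cell, odd eastern-ray count. [cite: Glazman2015WeightedSAW, Lemma 3.1 (proof, pp. 6–7)] [cite: CourantRobbins1958, Ch. V Appendix §2 (the even–odd rule)] -/
theorem ωsharpEPN_cert : ωsharpEPN.2.firstHitG = 12 ∧ ωsharpEPN.2.arcs.length = 34 ∧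
    (∀ j < 34, 12 < j → ωsharpEPN.2.fc j ≠ farW w42) ∧ ωsharpEPN.2.nth 12 = (farW w42).side .N ∧
    (ωsharpEPN.2.W1FreeOff (farW w42) ∧ ωsharpEPN.2.W2FreeOff (farW w42)) ∧
    Odd ((Finset.range 22).filter fun j => eastRayB w42 (ωsharpEPN.2.nth (12 + j + 1)) = true).card := by
  refine ⟨by decide, by decide, by decide, by decide, ⟨by unfold YBWalk.W1FreeOff; decide, by unfold YBWalk.W2FreeOff; decide⟩,
    by decide⟩

/-- The block at the root plaquette `w`. [cite: GlazmanManolescu2019, §2.1, §4.2 (translation invariance)] -/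
def sharpBlockEPN (w : Face) : List Face := sharpBlockEPN42.map (Face.shiftBy (refShift w))

/-- ★★★ The unmarked over wound witness `EPN` at EVERY POSITION: any face list containing the translated block carries a
wound class-`B2a` over-walk at the far cell, `w₁`-free and `w₂`-free off it.
[cite: GlazmanManolescu2019, §4.2 (translation invariance), Lemma 2.1]
[cite: Glazman2015WeightedSAW, Lemma 3.1 (proof, pp. 6–7)] [cite: CourantRobbins1958, Ch. V Appendix §2 (the even–odd rule)] -/
theorem exists_over_unmarked_of_sharpBlockEPN {Dl : List Face} {w : Face} (hB : ∀ c ∈ sharpBlockEPN w, c ∈ Dl)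
    (hr : RootedFace (dom Dl) (w.side .W) (farW w)) (θ : ℝ) :
    ∃ (ω : ΩG (dom Dl) (w.side .W) (farW w)) (h : ω.IsB2a), ω.2.firstSideG = .N ∧
      ω.WE (fun _ => θ) ≠ excursionWinding θ ω.2.firstSideG (ω.z1 hr h) ω.1 ∧
        (ω.2.W1FreeOff (farW w) ∧ ω.2.W2FreeOff (farW w)) := by
  have hB₀ := block42_mem_of_block_mem (B := sharpBlockEPN42) hB
  obtain ⟨hF, hn, hfc, hnth, hfree, hodd⟩ := ωsharpEPN_cert
  let ω₀ : ΩG (dom (Dl.map (Face.shiftBy (-refShift w)))) (w42.side .W) (farW w42) :=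
    ⟨.S, sharpEPNWalk.mapDomain fun c hc => hB₀ c hc⟩
  have hF' : ω₀.2.firstHitG = 12 := hF
  have hn' : ω₀.2.arcs.length = 34 := hn
  have h₀ : ω₀.IsB2a := by
    refine ΩG.isB2a_of_forall_fc_ne (by rw [hF', hn']; omega) fun j hj1 hj2 => ?_
    rw [hF'] at hj1
    rw [hn'] at hj2
    exact hfc j hj2 hj1
  have hM : ω₀.Mv = 22 := by unfold ΩG.Mv; rw [hF', hn']
  exact exists_wound_witness_shift (shiftBy_refShift_root w) (shiftBy_refShift_farW w) hr
    (fun γ r => γ.W1FreeOff r ∧ γ.W2FreeOff r)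
    (fun hm _ hf => ⟨YBWalk.W1FreeOff_of_mids_shift hm hf.1, YBWalk.W2FreeOff_of_mids_shift hm hf.2⟩) ω₀ h₀
    (by rw [hF']; exact hnth) hfree (by rw [hM, hF']; exact hodd) θ

end Witnesses

/-! ## §2 The top twin of the one-live-row box theorem; placement under a three-cell defect list -/

section TopTwin

variable {m n : ℕ} {S : List Face} {h : Face}

/-- ★★ **ALL BOXES, HOLE THREE ROWS BELOW THE TOP WALL (`h.2 + 4 = n`): the door `holeN | rootN` dead AND the side above it dead
(`(h.1, h.2 + 2)` or `(h.1 + 1, h.2 + 2)` removed) ⇒ NO WOUND OVER-WALK** (row `h.2 + 3` is the only live row above; the twin of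
`lawL_box_oneLiveRow3_not_wound_under` that the parent leaves implicit).
[cite: GlazmanManolescu2019, Lemma 2.1 (statement, "in the form given in [Gl]"), §2.1, §4.2]
[cite: Glazman2015WeightedSAW, Lemma 3.1 (proof, pp. 6–7)] [cite: CourantRobbins1958, Ch. V Appendix §2 (the even–odd rule)] -/
theorem lawL_box_oneLiveRowN3_not_wound_over (hW : 1 ≤ h.1) (hE : h.1 ≤ m) (hS0 : 0 ≤ h.2) (hN4 : h.2 + 4 = n) (hh : h ∈ S)
    (hfS : ((h.1 - 1, h.2) : Face) ∉ S) (hc2 : ((h.1, h.2 + 1) : Face) ∈ S ∨ ((h.1 + 1, h.2 + 1) : Face) ∈ S)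
    (hc1 : ((h.1, h.2 + 2) : Face) ∈ S ∨ ((h.1 + 1, h.2 + 2) : Face) ∈ S)
    (ω : ΩG (dom (boxMinus m n S)) (Face.side (h.1 + 1, h.2) .W) (farW (h.1 + 1, h.2))) (hb : ω.IsB2a)
    (hN' : ω.2.firstSideG = .N) (θ : ℝ) :
    ω.WE (fun _ => θ) = excursionWinding θ ω.2.firstSideG
      (ω.z1 (rootedFace_hroot_boxMinus_of_mem (farW_hroot_mem_boxMinus_of_not_mem hW hE hS0 (by omega) hfS) hh) hb)
      ω.1 := by
  have hhD : holeFaceW ((h.1 + 1, h.2) : Face) ∉ dom (boxMinus m n S) := by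
    rw [holeFaceW_hroot]; exact not_mem_dom_boxMinus_of_mem hh
  have out : ∀ y : ℤ, h.2 + 4 ≤ y → ((h.1 + 1 - 1, y) : Face) ∉ dom (boxMinus m n S) := by
    intro y hy hm; obtain ⟨hb', -⟩ := mem_dom_boxMinus.1 hm; simp only at hb'; omega
  have e1 : ∀ y : ℤ, ((h.1 + 1 - 1, y) : Face) = (h.1, y) := fun y => Prod.ext (by simp only; omega) rfl
  refine ΩG.WE_eq_excursionWinding_of_over_oneLiveRowN (y₁ := h.2 + 3) hhD (by simp only; omega) (fun y hy hne => ?_) ω _ hb hN' θ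
  simp only at hy hne ⊢
  rcases (show y = h.2 + 1 ∨ y = h.2 + 2 ∨ h.2 + 4 ≤ y by omega) with rfl | rfl | hg
  · rcases hc2 with hc | hc
    · left; rw [e1]; exact not_mem_dom_boxMinus_of_mem hc
    · right; exact not_mem_dom_boxMinus_of_mem hc
  · rcases hc1 with hc | hc
    · left; rw [e1]; exact not_mem_dom_boxMinus_of_mem hc
    · right; exact not_mem_dom_boxMinus_of_mem hc
  · exact Or.inl (out y hg)

/-- **Placement under a three-cell defect list** (cf. `block_hroot_subset_boxMinus_pair`): a reference block within the bounds avoiding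
the hole and three reference cells sits in `boxMinus m n S` for every `S` inside `{h, c + v, d + v, e + v}`.
[cite: GlazmanManolescu2019, §2.1 (finite domains of faces), §4.2 (translation invariance)] -/
theorem block_hroot_subset_boxMinus_triple (B : List Face) (x0 x1 y0 y1 : ℤ) (c d e : Face)
    (hB : ∀ a ∈ B, x0 ≤ a.1 ∧ a.1 ≤ x1 ∧ y0 ≤ a.2 ∧ a.2 ≤ y1 ∧ a ≠ (3, 2) ∧ a ≠ c ∧ a ≠ d ∧ a ≠ e)
    (hW : 3 ≤ x0 + h.1) (hE : x1 + h.1 ≤ m + 2) (hS : 2 ≤ y0 + h.2) (hN : y1 + h.2 ≤ n + 1)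
    (hSn : ∀ s ∈ S, s = h ∨ s = (c.1 + (h.1 - 3), c.2 + (h.2 - 2)) ∨ s = (d.1 + (h.1 - 3), d.2 + (h.2 - 2)) ∨
      s = (e.1 + (h.1 - 3), e.2 + (h.2 - 2))) :
    ∀ f ∈ B.map (Face.shiftBy (refShift (h.1 + 1, h.2))), f ∈ boxMinus m n S := by
  intro f hf
  rw [List.mem_map] at hf
  obtain ⟨a, ha, rfl⟩ := hf
  obtain ⟨b1, b2, b3, b4, b5, b6, b7, b8⟩ := hB a ha
  obtain ⟨x, y⟩ := a
  obtain ⟨c1, c2⟩ := c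
  obtain ⟨d1, d2⟩ := d
  obtain ⟨e1, e2⟩ := e
  simp only [ne_eq, Prod.mk.injEq, not_and] at b1 b2 b3 b4 b5 b6 b7 b8
  rw [shiftBy_refShift_mk, mem_boxMinus]
  refine ⟨⟨by omega, by omega, by omega, by omega⟩, fun hs => ?_⟩
  rcases hSn _ hs with q | q | q | q <;>
    (have q' := Prod.ext_iff.1 q; simp only at q'; omega)

/-- The far cell is none of the four cells when the three reference cells are not the reference far cell `(2, 2)`.
[cite: GlazmanManolescu2019, §2.1 (finite domains of faces)] -/
theorem farCell_not_mem_triple (c d e : Face) (hc : c ≠ (2, 2)) (hd : d ≠ (2, 2)) (he : e ≠ (2, 2))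
    (hSn : ∀ s ∈ S, s = h ∨ s = (c.1 + (h.1 - 3), c.2 + (h.2 - 2)) ∨ s = (d.1 + (h.1 - 3), d.2 + (h.2 - 2)) ∨
      s = (e.1 + (h.1 - 3), e.2 + (h.2 - 2))) :
    ((h.1 - 1, h.2) : Face) ∉ S := by
  intro hs
  obtain ⟨c1, c2⟩ := c
  obtain ⟨d1, d2⟩ := d
  obtain ⟨e1, e2⟩ := e
  simp only [ne_eq, Prod.mk.injEq, not_and] at hc hd he
  rcases hSn _ hs with q | q | q | q <;>
    (have q' := Prod.ext_iff.1 q; simp only at q'; omega)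

end TopTwin

/-! ## §3 The biconditionals -/

section SharpBoxes

variable {m n : ℕ} {S : List Face} {h : Face}

/-- The cells of `sharpBlockDH42`, in coordinates (decided on the list). [cite: GlazmanManolescu2019, §2.1 (finite domains of faces)] -/
theorem sharpBlockDH42_bounds : ∀ a ∈ sharpBlockDH42,
    1 ≤ a.1 ∧ a.1 ≤ 6 ∧ -2 ≤ a.2 ∧ a.2 ≤ 3 ∧ a ≠ (3, 2) ∧ a ≠ (3, 1) ∧ a ≠ (3, 0) ∧ a ≠ (4, 0) := by decide

/-- The cells of `sharpBlockDR42`, in coordinates (decided on the list). [cite: GlazmanManolescu2019, §2.1 (finite domains of faces)] -/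
theorem sharpBlockDR42_bounds : ∀ a ∈ sharpBlockDR42,
    1 ≤ a.1 ∧ a.1 ≤ 6 ∧ -2 ≤ a.2 ∧ a.2 ≤ 3 ∧ a ≠ (3, 2) ∧ a ≠ (4, 1) ∧ a ≠ (3, 0) ∧ a ≠ (4, 0) := by decide

/-- The cells of `sharpBlockEP42`, in coordinates (decided on the list). [cite: GlazmanManolescu2019, §2.1 (finite domains of faces)] -/
theorem sharpBlockEP42_bounds : ∀ a ∈ sharpBlockEP42,
    1 ≤ a.1 ∧ a.1 ≤ 7 ∧ -1 ≤ a.2 ∧ a.2 ≤ 4 ∧ a ≠ (3, 2) ∧ a ≠ (4, 1) ∧ a ≠ (5, 1) ∧ a ≠ (5, 2) := by decide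

/-- The cells of `sharpBlockDHN42`, in coordinates (decided on the list). [cite: GlazmanManolescu2019, §2.1 (finite domains of faces)] -/
theorem sharpBlockDHN42_bounds : ∀ a ∈ sharpBlockDHN42,
    1 ≤ a.1 ∧ a.1 ≤ 6 ∧ 1 ≤ a.2 ∧ a.2 ≤ 6 ∧ a ≠ (3, 2) ∧ a ≠ (3, 3) ∧ a ≠ (3, 4) ∧ a ≠ (4, 4) := by decide

/-- The cells of `sharpBlockDRN42`, in coordinates (decided on the list). [cite: GlazmanManolescu2019, §2.1 (finite domains of faces)] -/
theorem sharpBlockDRN42_bounds : ∀ a ∈ sharpBlockDRN42,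
    1 ≤ a.1 ∧ a.1 ≤ 6 ∧ 1 ≤ a.2 ∧ a.2 ≤ 6 ∧ a ≠ (3, 2) ∧ a ≠ (4, 3) ∧ a ≠ (3, 4) ∧ a ≠ (4, 4) := by decide

/-- The cells of `sharpBlockEPN42`, in coordinates (decided on the list). [cite: GlazmanManolescu2019, §2.1 (finite domains of faces)] -/
theorem sharpBlockEPN42_bounds : ∀ a ∈ sharpBlockEPN42,
    1 ≤ a.1 ∧ a.1 ≤ 7 ∧ 0 ≤ a.2 ∧ a.2 ≤ 5 ∧ a ≠ (3, 2) ∧ a ≠ (4, 3) ∧ a ≠ (5, 3) ∧ a ≠ (5, 2) := by decide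

/-- ★★★★★ **THE CUT CRITERION IS SHARP ON THE DEAD DOOR `holeS` WITH A CELL BEHIND IT.** In the `m × n` box with `2 ≤ h.1`,
`h.1 + 4 ≤ m`, `3 ≤ h.2`, `h.2 + 2 ≤ n`, remove the hole `h`, `holeS = (h.1, h.2 - 1)` and `holeSS = (h.1, h.2 − 2)` or `rootSS = (h.1 + 1, h.2 − 2)`
(`S ∋ h` any list inside the four-cell set containing `holeS` and one of the two). Then: NO class-`B2a` under-walk at the far cell is
wound ⟺ the floor is EXACTLY three rows below the hole (`h.2 = 3`: one live row, `lawL_box_oneLiveRow3_not_wound_under`); with a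
fourth row the unmarked 30-arc witness `sharpBlockDH` fits.
[cite: GlazmanManolescu2019, Lemma 2.1 (statement, "in the form given in [Gl]"), §2.1, §4.2]
[cite: Glazman2015WeightedSAW, Lemma 3.1 (proof, pp. 6–7)] [cite: CourantRobbins1958, Ch. V Appendix §2 (the even–odd rule)] -/
theorem lawL_box_holeS_doorBelow_not_wound_under_iff (hW : 2 ≤ h.1) (hE : h.1 + 4 ≤ m) (hS : 3 ≤ h.2) (hN : h.2 + 2 ≤ n)
    (hh : h ∈ S) (hcD : ((h.1, h.2 - 1) : Face) ∈ S) (hc1 : ((h.1, h.2 - 2) : Face) ∈ S ∨ ((h.1 + 1, h.2 - 2) : Face) ∈ S)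
    (hSn : ∀ s ∈ S, s = h ∨ s = (h.1, h.2 - 1) ∨ s = (h.1, h.2 - 2) ∨ s = (h.1 + 1, h.2 - 2))
    (hr : RootedFace (dom (boxMinus m n S)) (Face.side (h.1 + 1, h.2) .W) (farW (h.1 + 1, h.2))) (θ : ℝ) :
    (∀ (ω : ΩG (dom (boxMinus m n S)) (Face.side (h.1 + 1, h.2) .W) (farW (h.1 + 1, h.2))) (hb : ω.IsB2a),
        ω.2.firstSideG = .S → ω.WE (fun _ => θ) = excursionWinding θ ω.2.firstSideG (ω.z1 hr hb) ω.1) ↔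
      h.2 = 3 := by
  have hSn' : ∀ s ∈ S, s = h ∨ s = ((3 : ℤ) + (h.1 - 3), (1 : ℤ) + (h.2 - 2)) ∨ s = ((3 : ℤ) + (h.1 - 3), (0 : ℤ) + (h.2 - 2)) ∨
      s = ((4 : ℤ) + (h.1 - 3), (0 : ℤ) + (h.2 - 2)) := by
    intro s hs
    rcases hSn s hs with q | q | q | q
    · exact Or.inl q
    · exact Or.inr (Or.inl (by rw [q]; exact Prod.ext (by simp only; ring) (by simp only; ring)))
    · exact Or.inr (Or.inr (Or.inl (by rw [q]; exact Prod.ext (by simp only; ring) (by simp only; ring))))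
    · exact Or.inr (Or.inr (Or.inr (by rw [q]; exact Prod.ext (by simp only; ring) (by simp only; ring))))
  have hfS : ((h.1 - 1, h.2) : Face) ∉ S :=
    farCell_not_mem_triple (3, 1) (3, 0) (4, 0) (by decide) (by decide) (by decide) hSn'
  constructor
  · intro hall
    by_contra hgeo
    have h4 : 4 ≤ h.2 := by omega
    obtain ⟨ω, hb, hs, hw, -⟩ := exists_under_unmarked_of_sharpBlockDH
      (block_hroot_subset_boxMinus_triple sharpBlockDH42 1 6 (-2) 3 (3, 1) (3, 0) (4, 0) sharpBlockDH42_bounds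
        (by omega) (by omega) (by omega) (by omega) hSn') hr θ
    exact hw (hall ω hb hs)
  · intro h3 ω hb hs
    have hc2' : ((h.1, 2) : Face) ∈ S ∨ ((h.1 + 1, 2) : Face) ∈ S := by
      rw [show ((h.1, 2) : Face) = (h.1, h.2 - 1) from Prod.ext rfl (by simp only; omega),
        show ((h.1 + 1, 2) : Face) = (h.1 + 1, h.2 - 1) from Prod.ext rfl (by simp only; omega)]
      exact Or.inl hcD
    have hc1' : ((h.1, 1) : Face) ∈ S ∨ ((h.1 + 1, 1) : Face) ∈ S := by
      rw [show ((h.1, 1) : Face) = (h.1, h.2 - 2) from Prod.ext rfl (by simp only; omega),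
        show ((h.1 + 1, 1) : Face) = (h.1 + 1, h.2 - 2) from Prod.ext rfl (by simp only; omega)]
      exact hc1
    exact lawL_box_oneLiveRow3_not_wound_under (by omega) (by omega) h3 (by omega) hh hfS hc2' hc1' ω hb hs θ

/-- ★★★★★ **THE CUT CRITERION IS SHARP ON THE DEAD DOOR `rootS` WITH A CELL BEHIND IT.** In the `m × n` box with `2 ≤ h.1`,
`h.1 + 4 ≤ m`, `3 ≤ h.2`, `h.2 + 2 ≤ n`, remove the hole `h`, `rootS = (h.1 + 1, h.2 - 1)` and `holeSS = (h.1, h.2 − 2)` or `rootSS = (h.1 + 1, h.2 − 2)`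
(`S ∋ h` any list inside the four-cell set containing `rootS` and one of the two). Then: NO class-`B2a` under-walk at the far cell is
wound ⟺ the floor is EXACTLY three rows below the hole (`h.2 = 3`: one live row, `lawL_box_oneLiveRow3_not_wound_under`); with a
fourth row the unmarked 30-arc witness `sharpBlockDR` fits.
[cite: GlazmanManolescu2019, Lemma 2.1 (statement, "in the form given in [Gl]"), §2.1, §4.2]
[cite: Glazman2015WeightedSAW, Lemma 3.1 (proof, pp. 6–7)] [cite: CourantRobbins1958, Ch. V Appendix §2 (the even–odd rule)] -/
theorem lawL_box_rootS_doorBelow_not_wound_under_iff (hW : 2 ≤ h.1) (hE : h.1 + 4 ≤ m) (hS : 3 ≤ h.2) (hN : h.2 + 2 ≤ n)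
    (hh : h ∈ S) (hcD : ((h.1 + 1, h.2 - 1) : Face) ∈ S) (hc1 : ((h.1, h.2 - 2) : Face) ∈ S ∨ ((h.1 + 1, h.2 - 2) : Face) ∈ S)
    (hSn : ∀ s ∈ S, s = h ∨ s = (h.1 + 1, h.2 - 1) ∨ s = (h.1, h.2 - 2) ∨ s = (h.1 + 1, h.2 - 2))
    (hr : RootedFace (dom (boxMinus m n S)) (Face.side (h.1 + 1, h.2) .W) (farW (h.1 + 1, h.2))) (θ : ℝ) :
    (∀ (ω : ΩG (dom (boxMinus m n S)) (Face.side (h.1 + 1, h.2) .W) (farW (h.1 + 1, h.2))) (hb : ω.IsB2a),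
        ω.2.firstSideG = .S → ω.WE (fun _ => θ) = excursionWinding θ ω.2.firstSideG (ω.z1 hr hb) ω.1) ↔
      h.2 = 3 := by
  have hSn' : ∀ s ∈ S, s = h ∨ s = ((4 : ℤ) + (h.1 - 3), (1 : ℤ) + (h.2 - 2)) ∨ s = ((3 : ℤ) + (h.1 - 3), (0 : ℤ) + (h.2 - 2)) ∨
      s = ((4 : ℤ) + (h.1 - 3), (0 : ℤ) + (h.2 - 2)) := by
    intro s hs
    rcases hSn s hs with q | q | q | q
    · exact Or.inl q
    · exact Or.inr (Or.inl (by rw [q]; exact Prod.ext (by simp only; ring) (by simp only; ring)))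
    · exact Or.inr (Or.inr (Or.inl (by rw [q]; exact Prod.ext (by simp only; ring) (by simp only; ring))))
    · exact Or.inr (Or.inr (Or.inr (by rw [q]; exact Prod.ext (by simp only; ring) (by simp only; ring))))
  have hfS : ((h.1 - 1, h.2) : Face) ∉ S :=
    farCell_not_mem_triple (4, 1) (3, 0) (4, 0) (by decide) (by decide) (by decide) hSn'
  constructor
  · intro hall
    by_contra hgeo
    have h4 : 4 ≤ h.2 := by omega
    obtain ⟨ω, hb, hs, hw, -⟩ := exists_under_unmarked_of_sharpBlockDR
      (block_hroot_subset_boxMinus_triple sharpBlockDR42 1 6 (-2) 3 (4, 1) (3, 0) (4, 0) sharpBlockDR42_bounds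
        (by omega) (by omega) (by omega) (by omega) hSn') hr θ
    exact hw (hall ω hb hs)
  · intro h3 ω hb hs
    have hc2' : ((h.1, 2) : Face) ∈ S ∨ ((h.1 + 1, 2) : Face) ∈ S := by
      rw [show ((h.1, 2) : Face) = (h.1, h.2 - 1) from Prod.ext rfl (by simp only; omega),
        show ((h.1 + 1, 2) : Face) = (h.1 + 1, h.2 - 1) from Prod.ext rfl (by simp only; omega)]
      exact Or.inr hcD
    have hc1' : ((h.1, 1) : Face) ∈ S ∨ ((h.1 + 1, 1) : Face) ∈ S := by
      rw [show ((h.1, 1) : Face) = (h.1, h.2 - 2) from Prod.ext rfl (by simp only; omega),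
        show ((h.1 + 1, 1) : Face) = (h.1 + 1, h.2 - 2) from Prod.ext rfl (by simp only; omega)]
      exact hc1
    exact lawL_box_oneLiveRow3_not_wound_under (by omega) (by omega) h3 (by omega) hh hfS hc2' hc1' ω hb hs θ

/-- ★★★★★ **TWIN: THE CUT CRITERION IS SHARP ON THE DEAD DOOR `holeN` WITH A CELL ABOVE IT.** `2 ≤ h.1`, `h.1 + 4 ≤ m`, `1 ≤ h.2`,
`h.2 + 4 ≤ n`; `S ∋ h` inside `{h, holeN = (h.1, h.2 + 1), holeNN = (h.1, h.2 + 2), rootNN = (h.1 + 1, h.2 + 2)}` containing `holeN` and one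
of the two: NO wound class-`B2a` OVER-walk ⟺ `h.2 + 4 = n` (ceiling exactly three rows above, §2); otherwise `sharpBlockDHN` fits.
[cite: GlazmanManolescu2019, Lemma 2.1 (statement, "in the form given in [Gl]"), §2.1, §4.2]
[cite: Glazman2015WeightedSAW, Lemma 3.1 (proof, pp. 6–7)] [cite: CourantRobbins1958, Ch. V Appendix §2 (the even–odd rule)] -/
theorem lawL_box_holeN_doorAbove_not_wound_over_iff (hW : 2 ≤ h.1) (hE : h.1 + 4 ≤ m) (hS : 1 ≤ h.2) (hN : h.2 + 4 ≤ n)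
    (hh : h ∈ S) (hcD : ((h.1, h.2 + 1) : Face) ∈ S) (hc1 : ((h.1, h.2 + 2) : Face) ∈ S ∨ ((h.1 + 1, h.2 + 2) : Face) ∈ S)
    (hSn : ∀ s ∈ S, s = h ∨ s = (h.1, h.2 + 1) ∨ s = (h.1, h.2 + 2) ∨ s = (h.1 + 1, h.2 + 2))
    (hr : RootedFace (dom (boxMinus m n S)) (Face.side (h.1 + 1, h.2) .W) (farW (h.1 + 1, h.2))) (θ : ℝ) :
    (∀ (ω : ΩG (dom (boxMinus m n S)) (Face.side (h.1 + 1, h.2) .W) (farW (h.1 + 1, h.2))) (hb : ω.IsB2a),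
        ω.2.firstSideG = .N → ω.WE (fun _ => θ) = excursionWinding θ ω.2.firstSideG (ω.z1 hr hb) ω.1) ↔
      h.2 + 4 = n := by
  have hSn' : ∀ s ∈ S, s = h ∨ s = ((3 : ℤ) + (h.1 - 3), (3 : ℤ) + (h.2 - 2)) ∨ s = ((3 : ℤ) + (h.1 - 3), (4 : ℤ) + (h.2 - 2)) ∨
      s = ((4 : ℤ) + (h.1 - 3), (4 : ℤ) + (h.2 - 2)) := by
    intro s hs
    rcases hSn s hs with q | q | q | q
    · exact Or.inl q
    · exact Or.inr (Or.inl (by rw [q]; exact Prod.ext (by simp only; ring) (by simp only; ring)))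
    · exact Or.inr (Or.inr (Or.inl (by rw [q]; exact Prod.ext (by simp only; ring) (by simp only; ring))))
    · exact Or.inr (Or.inr (Or.inr (by rw [q]; exact Prod.ext (by simp only; ring) (by simp only; ring))))
  have hfS : ((h.1 - 1, h.2) : Face) ∉ S :=
    farCell_not_mem_triple (3, 3) (3, 4) (4, 4) (by decide) (by decide) (by decide) hSn'
  constructor
  · intro hall
    by_contra hgeo
    have h5 : h.2 + 5 ≤ n := by omega
    obtain ⟨ω, hb, hs, hw, -⟩ := exists_over_unmarked_of_sharpBlockDHN
      (block_hroot_subset_boxMinus_triple sharpBlockDHN42 1 6 1 6 (3, 3) (3, 4) (4, 4) sharpBlockDHN42_bounds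
        (by omega) (by omega) (by omega) (by omega) hSn') hr θ
    exact hw (hall ω hb hs)
  · intro h4 ω hb hs
    exact lawL_box_oneLiveRowN3_not_wound_over (by omega) (by omega) (by omega) h4 hh hfS
      (Or.inl hcD) hc1 ω hb hs θ

/-- ★★★★★ **TWIN: THE CUT CRITERION IS SHARP ON THE DEAD DOOR `rootN` WITH A CELL ABOVE IT.** `2 ≤ h.1`, `h.1 + 4 ≤ m`, `1 ≤ h.2`,
`h.2 + 4 ≤ n`; `S ∋ h` inside `{h, rootN = (h.1 + 1, h.2 + 1), holeNN = (h.1, h.2 + 2), rootNN = (h.1 + 1, h.2 + 2)}` containing `rootN` and one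
of the two: NO wound class-`B2a` OVER-walk ⟺ `h.2 + 4 = n` (ceiling exactly three rows above, §2); otherwise `sharpBlockDRN` fits.
[cite: GlazmanManolescu2019, Lemma 2.1 (statement, "in the form given in [Gl]"), §2.1, §4.2]
[cite: Glazman2015WeightedSAW, Lemma 3.1 (proof, pp. 6–7)] [cite: CourantRobbins1958, Ch. V Appendix §2 (the even–odd rule)] -/
theorem lawL_box_rootN_doorAbove_not_wound_over_iff (hW : 2 ≤ h.1) (hE : h.1 + 4 ≤ m) (hS : 1 ≤ h.2) (hN : h.2 + 4 ≤ n)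
    (hh : h ∈ S) (hcD : ((h.1 + 1, h.2 + 1) : Face) ∈ S) (hc1 : ((h.1, h.2 + 2) : Face) ∈ S ∨ ((h.1 + 1, h.2 + 2) : Face) ∈ S)
    (hSn : ∀ s ∈ S, s = h ∨ s = (h.1 + 1, h.2 + 1) ∨ s = (h.1, h.2 + 2) ∨ s = (h.1 + 1, h.2 + 2))
    (hr : RootedFace (dom (boxMinus m n S)) (Face.side (h.1 + 1, h.2) .W) (farW (h.1 + 1, h.2))) (θ : ℝ) :
    (∀ (ω : ΩG (dom (boxMinus m n S)) (Face.side (h.1 + 1, h.2) .W) (farW (h.1 + 1, h.2))) (hb : ω.IsB2a),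
        ω.2.firstSideG = .N → ω.WE (fun _ => θ) = excursionWinding θ ω.2.firstSideG (ω.z1 hr hb) ω.1) ↔
      h.2 + 4 = n := by
  have hSn' : ∀ s ∈ S, s = h ∨ s = ((4 : ℤ) + (h.1 - 3), (3 : ℤ) + (h.2 - 2)) ∨ s = ((3 : ℤ) + (h.1 - 3), (4 : ℤ) + (h.2 - 2)) ∨
      s = ((4 : ℤ) + (h.1 - 3), (4 : ℤ) + (h.2 - 2)) := by
    intro s hs
    rcases hSn s hs with q | q | q | q
    · exact Or.inl q
    · exact Or.inr (Or.inl (by rw [q]; exact Prod.ext (by simp only; ring) (by simp only; ring)))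
    · exact Or.inr (Or.inr (Or.inl (by rw [q]; exact Prod.ext (by simp only; ring) (by simp only; ring))))
    · exact Or.inr (Or.inr (Or.inr (by rw [q]; exact Prod.ext (by simp only; ring) (by simp only; ring))))
  have hfS : ((h.1 - 1, h.2) : Face) ∉ S :=
    farCell_not_mem_triple (4, 3) (3, 4) (4, 4) (by decide) (by decide) (by decide) hSn'
  constructor
  · intro hall
    by_contra hgeo
    have h5 : h.2 + 5 ≤ n := by omega
    obtain ⟨ω, hb, hs, hw, -⟩ := exists_over_unmarked_of_sharpBlockDRN
      (block_hroot_subset_boxMinus_triple sharpBlockDRN42 1 6 1 6 (4, 3) (3, 4) (4, 4) sharpBlockDRN42_bounds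
        (by omega) (by omega) (by omega) (by omega) hSn') hr θ
    exact hw (hall ω hb hs)
  · intro h4 ω hb hs
    exact lawL_box_oneLiveRowN3_not_wound_over (by omega) (by omega) (by omega) h4 hh hfS
      (Or.inr hcD) hc1 ω hb hs θ

/-- ★★★★★ **THE CUT CRITERION IS SHARP ON THE ROOT NOTCH WITH THE FIRST RAY CELL.** In the `m × n` box with `2 ≤ h.1`, `h.1 + 4 ≤ m`,
`3 ≤ h.2`, `h.2 + 3 ≤ n`, remove the hole `h`, `rootS = (h.1 + 1, h.2 − 1)` and `rootE = (h.1 + 2, h.2)` or `pocketSE = (h.1 + 2, h.2 − 1)`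
(`S ∋ h` inside the four-cell set, containing `rootS` and one of the two). Then: NO class-`B2a` under-walk at the far cell is wound ⟺
the east wall is EXACTLY two columns beyond the root plaquette (`h.1 + 4 = m`: one live ray column,
`lawL_box_rootS_rootEcol_not_wound_under`); with a third column the unmarked 34-arc witness `sharpBlockEP` fits.
[cite: GlazmanManolescu2019, Lemma 2.1 (statement, "in the form given in [Gl]"), §2.1, §4.2]
[cite: Glazman2015WeightedSAW, Lemma 3.1 (proof, pp. 6–7)] [cite: CourantRobbins1958, Ch. V Appendix §2 (the even–odd rule)] -/
theorem lawL_box_rootS_eastPair_not_wound_under_iff (hW : 2 ≤ h.1) (hE : h.1 + 4 ≤ m) (hS : 3 ≤ h.2) (hN : h.2 + 3 ≤ n)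
    (hh : h ∈ S) (hcS : ((h.1 + 1, h.2 - 1) : Face) ∈ S)
    (hcE : ((h.1 + 2, h.2) : Face) ∈ S ∨ ((h.1 + 2, h.2 - 1) : Face) ∈ S)
    (hSn : ∀ s ∈ S, s = h ∨ s = (h.1 + 1, h.2 - 1) ∨ s = (h.1 + 2, h.2 - 1) ∨ s = (h.1 + 2, h.2))
    (hr : RootedFace (dom (boxMinus m n S)) (Face.side (h.1 + 1, h.2) .W) (farW (h.1 + 1, h.2))) (θ : ℝ) :
    (∀ (ω : ΩG (dom (boxMinus m n S)) (Face.side (h.1 + 1, h.2) .W) (farW (h.1 + 1, h.2))) (hb : ω.IsB2a),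
        ω.2.firstSideG = .S → ω.WE (fun _ => θ) = excursionWinding θ ω.2.firstSideG (ω.z1 hr hb) ω.1) ↔
      h.1 + 4 = m := by
  have hSn' : ∀ s ∈ S, s = h ∨ s = ((4 : ℤ) + (h.1 - 3), (1 : ℤ) + (h.2 - 2)) ∨ s = ((5 : ℤ) + (h.1 - 3), (1 : ℤ) + (h.2 - 2)) ∨
      s = ((5 : ℤ) + (h.1 - 3), (2 : ℤ) + (h.2 - 2)) := by
    intro s hs
    rcases hSn s hs with q | q | q | q
    · exact Or.inl q
    · exact Or.inr (Or.inl (by rw [q]; exact Prod.ext (by simp only; ring) (by simp only; ring)))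
    · exact Or.inr (Or.inr (Or.inl (by rw [q]; exact Prod.ext (by simp only; ring) (by simp only; ring))))
    · exact Or.inr (Or.inr (Or.inr (by rw [q]; exact Prod.ext (by simp only; ring) (by simp only; ring))))
  have hfS : ((h.1 - 1, h.2) : Face) ∉ S :=
    farCell_not_mem_triple (4, 1) (5, 1) (5, 2) (by decide) (by decide) (by decide) hSn'
  constructor
  · intro hall
    by_contra hgeo
    have h5 : h.1 + 5 ≤ m := by omega
    obtain ⟨ω, hb, hs, hw, -⟩ := exists_under_unmarked_of_sharpBlockEP
      (block_hroot_subset_boxMinus_triple sharpBlockEP42 1 7 (-1) 4 (4, 1) (5, 1) (5, 2) sharpBlockEP42_bounds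
        (by omega) (by omega) (by omega) (by omega) hSn') hr θ
    exact hw (hall ω hb hs)
  · intro h4 ω hb hs
    exact lawL_box_rootS_rootEcol_not_wound_under (by omega) h4 (by omega) (by omega) hh hfS hcS hcE ω hb hs θ

/-- ★★★★★ **TWIN: THE CUT CRITERION IS SHARP ON `rootN` WITH `rootE | pocketNE`.** `2 ≤ h.1`, `h.1 + 4 ≤ m`, `2 ≤ h.2`, `h.2 + 4 ≤ n`;
`S ∋ h` inside `{h, rootN = (h.1 + 1, h.2 + 1), pocketNE = (h.1 + 2, h.2 + 1), rootE = (h.1 + 2, h.2)}` containing `rootN` and `rootE` or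
`pocketNE`: NO wound class-`B2a` OVER-walk ⟺ `h.1 + 4 = m`.
[cite: GlazmanManolescu2019, Lemma 2.1 (statement, "in the form given in [Gl]"), §2.1, §4.2]
[cite: Glazman2015WeightedSAW, Lemma 3.1 (proof, pp. 6–7)] [cite: CourantRobbins1958, Ch. V Appendix §2 (the even–odd rule)] -/
theorem lawL_box_rootN_eastPair_not_wound_over_iff (hW : 2 ≤ h.1) (hE : h.1 + 4 ≤ m) (hS : 2 ≤ h.2) (hN : h.2 + 4 ≤ n)
    (hh : h ∈ S) (hcN : ((h.1 + 1, h.2 + 1) : Face) ∈ S)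
    (hcE : ((h.1 + 2, h.2) : Face) ∈ S ∨ ((h.1 + 2, h.2 + 1) : Face) ∈ S)
    (hSn : ∀ s ∈ S, s = h ∨ s = (h.1 + 1, h.2 + 1) ∨ s = (h.1 + 2, h.2 + 1) ∨ s = (h.1 + 2, h.2))
    (hr : RootedFace (dom (boxMinus m n S)) (Face.side (h.1 + 1, h.2) .W) (farW (h.1 + 1, h.2))) (θ : ℝ) :
    (∀ (ω : ΩG (dom (boxMinus m n S)) (Face.side (h.1 + 1, h.2) .W) (farW (h.1 + 1, h.2))) (hb : ω.IsB2a),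
        ω.2.firstSideG = .N → ω.WE (fun _ => θ) = excursionWinding θ ω.2.firstSideG (ω.z1 hr hb) ω.1) ↔
      h.1 + 4 = m := by
  have hSn' : ∀ s ∈ S, s = h ∨ s = ((4 : ℤ) + (h.1 - 3), (3 : ℤ) + (h.2 - 2)) ∨ s = ((5 : ℤ) + (h.1 - 3), (3 : ℤ) + (h.2 - 2)) ∨
      s = ((5 : ℤ) + (h.1 - 3), (2 : ℤ) + (h.2 - 2)) := by
    intro s hs
    rcases hSn s hs with q | q | q | q
    · exact Or.inl q
    · exact Or.inr (Or.inl (by rw [q]; exact Prod.ext (by simp only; ring) (by simp only; ring)))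
    · exact Or.inr (Or.inr (Or.inl (by rw [q]; exact Prod.ext (by simp only; ring) (by simp only; ring))))
    · exact Or.inr (Or.inr (Or.inr (by rw [q]; exact Prod.ext (by simp only; ring) (by simp only; ring))))
  have hfS : ((h.1 - 1, h.2) : Face) ∉ S :=
    farCell_not_mem_triple (4, 3) (5, 3) (5, 2) (by decide) (by decide) (by decide) hSn'
  constructor
  · intro hall
    by_contra hgeo
    have h5 : h.1 + 5 ≤ m := by omega
    obtain ⟨ω, hb, hs, hw, -⟩ := exists_over_unmarked_of_sharpBlockEPN
      (block_hroot_subset_boxMinus_triple sharpBlockEPN42 1 7 0 5 (4, 3) (5, 3) (5, 2) sharpBlockEPN42_bounds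
        (by omega) (by omega) (by omega) (by omega) hSn') hr θ
    exact hw (hall ω hb hs)
  · intro h4 ω hb hs
    exact lawL_box_rootN_rootEcol_not_wound_over (by omega) h4 (by omega) (by omega) hh hfS hcN hcE ω hb hs θ

end SharpBoxes

end Literature.Barriers.CriticalPhenomena.PlaquetteWalk
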